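import Mathlib
import Literature.Combinatorics.ZeroPatterns
import HarnessLib

/-!
# Hitting sets from a polynomial parametrisation of the coefficient vectors
# (Heintz–Schnorr 1980 / Chatterjee–Kumar–Ramya–Saptharishi–Tengse 2020, Lemma 3.7 — abstract form)

Topic `Literature/Computability/AlgebraicComplexity`; the abstract core of `HittingSetsExist.lean`
(which treats the class `{deg ≤ d, L ≤ s}` through the universal circuit). **Theorem
(`CoeffCover.exists_hittingSet`).** Let `M` be the set of monomials of degree `≤ d` in `n`
variables over a field `F`, and `G : M → F[y₁,…,y_p]` a polynomial map with coordinates of degree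
`≤ δ` ("a universal map for the class", CKRST v4 Lemmas 3.5–3.7). For every finite nonempty
`S ⊆ F` with `|S| ≥ 2d` there is `H ⊆ Sⁿ`, `#H ≤ p·(log₂(|S|ⁿ δ + 1) + 1) + 1`, such that every
NONZERO `f` of degree `≤ d` whose coefficient vector on `M` is a value `G(y)` satisfies
`f(a) ≠ 0` for some `a ∈ H`. Proof: the polynomials `y ↦ f_y(a)` (`a ∈ Sⁿ`, `f_y = Σ_m G_m(y) x^m`)
have at most `(|S|ⁿδ + 1)^p` zero-patterns (Rónyai–Babai–Ganapathy,
`Literature.Combinatorics.RBG.card_patterns_le_pow`), each zero set `{a : f_y(a) = 0}` with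
`f_y ≠ 0` has `≤ d |S|ⁿ⁻¹` points (Schwartz–Zippel), and `#patterns · d^t < |S|^t` once
`2^t > #patterns` — so some `t`-tuple of grid points hits every nonzero `f_y`.

Used for the exponential-sum (VNP) slices, whose coefficient vectors are parametrised by CKRST's
universal map for definable polynomials (`CKRST2020_lemma20_holds`), in
`Literature/Barriers/ValiantsHypothesis/CKRST20ExpSumHittingSets.lean`.

## References

* [HeintzSchnorr1980] Thm. 4.4 (existence of small hitting sets for easy polynomials).
* [ChatterjeeKumarRamyaSaptharishiTengse2020] arXiv v4 Lemmas 3.5–3.7 (universal maps and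
  non-explicit hitting sets for `Circuit` and `ExpSum`). locator: paper:arxiv-2004.14147 p0013–p0014.
* [RonyaiBabaiGanapathy2001] Thm. 1.1.
-/

noncomputable section

open MvPolynomial Finset

namespace Literature.Computability.AlgebraicComplexity

namespace CoeffCover

variable {F : Type*} [Field F] {n d p : ℕ}

/-- The polynomial with coefficient vector `G(y)`: `f_y = Σ_{m ∈ M} G_m(y) · x^m`.
[cite: ChatterjeeKumarRamyaSaptharishiTengse2020, Lemma 3.5 (arXiv v4)] -/
private def valuePoly [Fintype {m : Fin n →₀ ℕ | m.degree ≤ d}]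
    (G : {m : Fin n →₀ ℕ | m.degree ≤ d} → MvPolynomial (Fin p) F) (y : Fin p → F) :
    MvPolynomial (Fin n) F :=
  ∑ m : {m : Fin n →₀ ℕ | m.degree ≤ d}, monomial (m : Fin n →₀ ℕ) (eval y (G m))

/-- The evaluation functional at the point `a`, as a polynomial in the parameters:
`g_a = Σ_{m ∈ M} a^m · G_m`. [cite: ChatterjeeKumarRamyaSaptharishiTengse2020, Lemma 3.7 (arXiv v4)] -/
private def pointPoly [Fintype {m : Fin n →₀ ℕ | m.degree ≤ d}]
    (G : {m : Fin n →₀ ℕ | m.degree ≤ d} → MvPolynomial (Fin p) F) (a : Fin n → F) :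
    MvPolynomial (Fin p) F :=
  ∑ m : {m : Fin n →₀ ℕ | m.degree ≤ d}, C (∏ i, a i ^ (m : Fin n →₀ ℕ) i) * G m

variable [Fintype {m : Fin n →₀ ℕ | m.degree ≤ d}]
  (G : {m : Fin n →₀ ℕ | m.degree ≤ d} → MvPolynomial (Fin p) F)

/-- `f_y` has degree `≤ d`. [folklore] -/
private theorem totalDegree_valuePoly_le (y : Fin p → F) : (valuePoly G y).totalDegree ≤ d := by
  refine totalDegree_finsetSum_le fun m _ => (totalDegree_monomial_le _ _).trans ?_
  exact m.2

/-- `g_a` has degree `≤ δ` if every `G_m` has. [folklore] -/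
private theorem totalDegree_pointPoly_le {δ : ℕ} (hδ : ∀ m, (G m).totalDegree ≤ δ)
    (a : Fin n → F) : (pointPoly G a).totalDegree ≤ δ := by
  refine totalDegree_finsetSum_le fun m _ => (totalDegree_mul _ _).trans ?_
  rw [totalDegree_C, zero_add]
  exact hδ m

/-- `g_a(y) = f_y(a)`. [folklore] -/
private theorem eval_pointPoly_eq_eval_valuePoly (a : Fin n → F) (y : Fin p → F) :
    eval y (pointPoly G a) = eval a (valuePoly G y) := by
  simp only [pointPoly, valuePoly, map_sum, map_mul, eval_C, eval_monomial]
  refine Finset.sum_congr rfl fun m _ => ?_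
  rw [Finsupp.prod_fintype _ _ (fun _ => pow_zero _), mul_comm]

/-- A polynomial of degree `≤ d` covered by `G` at `y` IS `f_y`. [folklore] -/
private theorem eq_valuePoly_of_cover {f : MvPolynomial (Fin n) F} (hf : f.totalDegree ≤ d)
    {y : Fin p → F} (hy : ∀ m, eval y (G m) = coeff (m : Fin n →₀ ℕ) f) : f = valuePoly G y := by
  classical
  ext ν
  simp only [valuePoly, coeff_sum, coeff_monomial]
  by_cases hν : ν.degree ≤ d
  · rw [Finset.sum_eq_single (⟨ν, hν⟩ : {m : Fin n →₀ ℕ | m.degree ≤ d})]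
    · simp [hy]
    · intro m _ hm
      rw [if_neg]
      exact fun h => hm (Subtype.ext h)
    · intro h; exact absurd (Finset.mem_univ _) h
  · rw [Finset.sum_eq_zero]
    · by_contra hne
      apply hν
      have hmem : ν ∈ f.support := mem_support_iff.mpr hne
      have h2 : ν.degree ≤ f.totalDegree := le_totalDegree hmem
      exact h2.trans hf
    · intro m _
      rw [if_neg]
      intro h
      exact hν (h ▸ m.2)

omit [Fintype {m : Fin n →₀ ℕ | m.degree ≤ d}] in
/-- Schwartz–Zippel in product form on the grid `Sⁿ`. [folklore] -/
private theorem card_zeros_mul_le [DecidableEq F] {g : MvPolynomial (Fin n) F} (hg : g ≠ 0)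
    {d : ℕ} (hd : g.totalDegree ≤ d) (S : Finset F) :
    ((Fintype.piFinset fun _ : Fin n => S).filter (fun a => eval a g = 0)).card * S.card ≤
      d * S.card ^ n := by
  -- adapted from HittingSetsExist.lean
  rcases S.eq_empty_or_nonempty with hS0 | hS
  · rw [hS0, Finset.card_empty, mul_zero]; exact Nat.zero_le _
  have hSpos : (0 : ℚ≥0) < S.card := by exact_mod_cast hS.card_pos
  have h := schwartz_zippel_totalDegree hg S
  rw [div_le_div_iff₀ (by positivity) hSpos] at h
  have h' : (((Fintype.piFinset fun _ : Fin n => S).filter (fun a => eval a g = 0)).card : ℚ≥0) *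
      S.card ≤ d * (S.card : ℚ≥0) ^ n :=
    h.trans (by gcongr)
  exact_mod_cast h'

end CoeffCover

namespace CoeffCover

variable {F : Type*} [Field F]

/-- **Hitting sets from a coefficient parametrisation (HS80 Thm. 4.4 / CKRST v4 Lemma 3.7,
abstract form).** If the coefficient vectors (on the monomials of degree `≤ d`) of a class of
degree-`≤ d` polynomials in `n` variables are values of a polynomial map `G` with `p` parameters
and coordinates of degree `≤ δ`, then for every finite nonempty `S ⊆ F` with `2d ≤ |S|` some
`H ⊆ Sⁿ` with `#H ≤ p (log₂(|S|ⁿ δ + 1) + 1) + 1` hits every nonzero member of the class.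
[cite: HeintzSchnorr1980, Thm. 4.4] -/
theorem exists_hittingSet (n d p δ : ℕ) (hM : ({m : Fin n →₀ ℕ | m.degree ≤ d} : Set _).Finite)
    (Gm : {m : Fin n →₀ ℕ | m.degree ≤ d} → MvPolynomial (Fin p) F)
    (hδ : ∀ m, (Gm m).totalDegree ≤ δ) (S : Finset F) (hS1 : S.Nonempty) (hS : 2 * d ≤ S.card) :
    ∃ H : Finset (Fin n → F), (∀ a ∈ H, ∀ i, a i ∈ S) ∧
      H.card ≤ p * (Nat.log 2 (S.card ^ n * δ + 1) + 1) + 1 ∧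
      ∀ f : MvPolynomial (Fin n) F, f.totalDegree ≤ d →
        (∃ y : Fin p → F, ∀ m, eval y (Gm m) = coeff (m : Fin n →₀ ℕ) f) → f ≠ 0 →
        ∃ a ∈ H, eval a f ≠ 0 := by
  classical
  haveI : Fintype {m : Fin n →₀ ℕ | m.degree ≤ d} := hM.fintype
  -- the grid and the family of parameter-polynomials indexed by it
  set G : Finset (Fin n → F) := Fintype.piFinset fun _ : Fin n => S with hG
  have hGcard : G.card = S.card ^ n := by
    rw [hG, Fintype.card_piFinset, Finset.prod_const, Finset.card_univ, Fintype.card_fin]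
  let g : G → MvPolynomial (Fin p) F := fun a => pointPoly Gm a.1
  -- the two parameters, kept opaque
  obtain ⟨D, hD⟩ : ∃ D, D = S.card ^ n * δ := ⟨_, rfl⟩
  obtain ⟨t, ht⟩ : ∃ t, t = p * (Nat.log 2 (D + 1) + 1) + 1 := ⟨_, rfl⟩
  have ht0 : t ≠ 0 := by rw [ht]; omega
  have hSpos : 0 < S.card := Finset.card_pos.mpr hS1
  have hGne : (fun _ : Fin n => Classical.choice (Finset.card_pos.mp hSpos).to_subtype |>.1) ∈ G := by
    rw [hG, Fintype.mem_piFinset]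
    intro i
    exact (Classical.choice (Finset.card_pos.mp hSpos).to_subtype).2
  -- (1) few zero-patterns
  have hpat : (Literature.Combinatorics.RBG.patterns g).card < 2 ^ t := by
    have hsum : ∑ a : G, (g a).totalDegree ≤ D := by
      calc ∑ a : G, (g a).totalDegree ≤ ∑ _a : G, δ :=
            Finset.sum_le_sum fun a _ => totalDegree_pointPoly_le Gm hδ a.1
        _ = D := by
            rw [Finset.sum_const, Finset.card_univ, Fintype.card_coe, hGcard, smul_eq_mul, hD]
    refine (Literature.Combinatorics.RBG.card_patterns_le_pow g hsum).trans_lt ?_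
    rw [Fintype.card_fin]
    have h1 : D + 1 < 2 ^ (Nat.log 2 (D + 1) + 1) := Nat.lt_pow_succ_log_self (by norm_num) _
    calc (D + 1) ^ p ≤ (2 ^ (Nat.log 2 (D + 1) + 1)) ^ p := Nat.pow_le_pow_left h1.le p
      _ = 2 ^ (p * (Nat.log 2 (D + 1) + 1)) := by rw [← pow_mul, mul_comm]
      _ < 2 ^ t := Nat.pow_lt_pow_right (by norm_num) (by rw [ht]; omega)
  -- (2) the zero set of a pattern, and its size when it comes from a nonzero specialisation
  let zeros : Finset G → Finset G := fun P => Finset.univ.filter fun a => a ∉ P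
  have hzeros_spec : ∀ (y : Fin p → F) (a : G),
      a ∈ zeros (Literature.Combinatorics.RBG.supportPattern g y) ↔
        eval a.1 (valuePoly Gm y) = 0 := by
    intro y a
    simp only [zeros, Finset.mem_filter, Finset.mem_univ, true_and,
      Literature.Combinatorics.RBG.mem_supportPattern, not_not, g]
    rw [eval_pointPoly_eq_eval_valuePoly]
  have hzeros_card : ∀ y : Fin p → F, valuePoly Gm y ≠ 0 →
      (zeros (Literature.Combinatorics.RBG.supportPattern g y)).card * S.card ≤ d * S.card ^ n := by
    intro y hy
    have hle : (zeros (Literature.Combinatorics.RBG.supportPattern g y)).card ≤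
        (G.filter (fun a => eval a (valuePoly Gm y) = 0)).card := by
      refine Finset.card_le_card_of_injOn (fun a : G => a.1) (fun a ha => ?_)
        (fun a _ b _ h => Subtype.ext h)
      rw [Finset.mem_coe, Finset.mem_filter]
      exact ⟨a.2, (hzeros_spec y a).mp (Finset.mem_coe.mp ha)⟩
    refine (Nat.mul_le_mul_right _ hle).trans ?_
    rw [hG]
    exact card_zeros_mul_le hy (totalDegree_valuePoly_le Gm y) S
  -- (3) counting: some `t`-tuple of grid points avoids every small zero set
  let Pats := (Literature.Combinatorics.RBG.patterns g).filter
    fun P => (zeros P).card * S.card ≤ d * S.card ^ n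
  let bad : Finset (Fin t → G) := Pats.biUnion fun P => Fintype.piFinset fun _ : Fin t => zeros P
  have hbad : bad.card < (Finset.univ : Finset (Fin t → G)).card := by
    have h1 : bad.card ≤ ∑ P ∈ Pats, (zeros P).card ^ t := by
      refine Finset.card_biUnion_le.trans (Finset.sum_le_sum fun P _ => ?_)
      rw [Fintype.card_piFinset, Finset.prod_const, Finset.card_univ, Fintype.card_fin]
    have h2 : ∀ P ∈ Pats, (zeros P).card ^ t * S.card ^ t ≤ (d * S.card ^ n) ^ t := by
      intro P hP
      rw [← mul_pow]
      exact Nat.pow_le_pow_left (Finset.mem_filter.mp hP).2 t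
    have hΩ : (Finset.univ : Finset (Fin t → G)).card = (S.card ^ n) ^ t := by
      rw [Finset.card_univ, Fintype.card_fun, Fintype.card_fin, Fintype.card_coe, hGcard]
    have h3 : bad.card * S.card ^ t ≤ Pats.card * (d * S.card ^ n) ^ t := by
      calc bad.card * S.card ^ t ≤ (∑ P ∈ Pats, (zeros P).card ^ t) * S.card ^ t :=
            Nat.mul_le_mul_right _ h1
        _ = ∑ P ∈ Pats, (zeros P).card ^ t * S.card ^ t := Finset.sum_mul _ _ _
        _ ≤ ∑ P ∈ Pats, (d * S.card ^ n) ^ t := Finset.sum_le_sum h2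
        _ = Pats.card * (d * S.card ^ n) ^ t := by rw [Finset.sum_const, smul_eq_mul]
    have h4 : Pats.card < 2 ^ t := (Finset.card_filter_le _ _).trans_lt hpat
    have hlt : Pats.card * d ^ t < S.card ^ t := by
      rcases Nat.eq_zero_or_pos d with hd0 | hdpos
      · rw [hd0, zero_pow ht0, mul_zero]; exact Nat.pow_pos hSpos
      · calc Pats.card * d ^ t < 2 ^ t * d ^ t := Nat.mul_lt_mul_of_pos_right h4 (Nat.pow_pos hdpos)
          _ = (2 * d) ^ t := (mul_pow 2 d t).symm
          _ ≤ S.card ^ t := Nat.pow_le_pow_left hS t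
    have h6 : bad.card * S.card ^ t < (Finset.univ : Finset (Fin t → G)).card * S.card ^ t := by
      calc bad.card * S.card ^ t ≤ Pats.card * (d * S.card ^ n) ^ t := h3
        _ = Pats.card * d ^ t * (S.card ^ n) ^ t := by rw [mul_pow, mul_assoc]
        _ < S.card ^ t * (S.card ^ n) ^ t :=
            Nat.mul_lt_mul_of_pos_right hlt (Nat.pow_pos (by rw [← hGcard]; exact Finset.card_pos.mpr ⟨_, hGne⟩))
        _ = (Finset.univ : Finset (Fin t → G)).card * S.card ^ t := by rw [hΩ, mul_comm]
    exact Nat.lt_of_mul_lt_mul_right h6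
  obtain ⟨ω, -, hωbad⟩ : ∃ ω ∈ (Finset.univ : Finset (Fin t → G)), ω ∉ bad := by
    by_contra hcon
    push Not at hcon
    exact absurd (Finset.card_le_card hcon) (not_le.mpr hbad)
  -- (4) the hitting set
  refine ⟨Finset.univ.image fun k => (ω k).1, ?_, ?_, ?_⟩
  · intro a ha i
    obtain ⟨k, -, rfl⟩ := Finset.mem_image.mp ha
    exact Fintype.mem_piFinset.mp (ω k).2 i
  · calc (Finset.univ.image fun k => (ω k).1).card ≤ (Finset.univ : Finset (Fin t)).card :=
          Finset.card_image_le
      _ = t := by simp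
      _ ≤ p * (Nat.log 2 (S.card ^ n * δ + 1) + 1) + 1 := by rw [ht, ← hD]
  · intro f hfd hcov hf0
    obtain ⟨α, hα⟩ := hcov
    have hfy : valuePoly Gm α = f := (eq_valuePoly_of_cover Gm hfd hα).symm
    by_contra hall
    push Not at hall
    apply hωbad
    have hP : Literature.Combinatorics.RBG.supportPattern g α ∈ Pats := by
      refine Finset.mem_filter.mpr ⟨Literature.Combinatorics.RBG.supportPattern_mem_patterns g α, ?_⟩
      exact hzeros_card α (by rw [hfy]; exact hf0)
    refine Finset.mem_biUnion.mpr ⟨_, hP, Fintype.mem_piFinset.mpr fun k => ?_⟩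
    rw [hzeros_spec α (ω k), hfy]
    exact hall (ω k).1 (Finset.mem_image.mpr ⟨k, Finset.mem_univ _, rfl⟩)


end CoeffCover

end Literature.Computability.AlgebraicComplexity

end
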